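import Literature.NumberTheory.EllipticCurves.TateCurve.NumberFieldUniformizationTwisted
import HarnessLib

/-!
# Tate's twisted `v`-adic uniformisation at a multiplicative place WITH the `j`-clause `j(E_q) = j(E)`
# and the valuation of the Tate parameter (Silverman, *Advanced Topics*, Thm. V.5.3 (a),(b), Lemma V.5.1)

Topic `Literature/NumberTheory/EllipticCurves/TateCurve`, namespace
`Literature.NumberTheory.EllipticCurves.TateCurve`. Proof-only file (theorems only; no definition, no named
fact), a re-assembly of the tree's DISCHARGED named fact `Silverman1994_thmV53_corV54_tateUniformisation`
(`NumberFieldUniformizationTwisted.lean`, abc-iut-w5-d205) and of its valuation variant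
(`NumberFieldUniformizationTwistedValuation.lean`) that ALSO exports the clause the two predecessors drop:

* `exists_twistedTateUniformisation_tateJ`: for an elliptic curve `W` over a number field `K` (universe `0`)
  with multiplicative reduction at `v`, there are `q ∈ K_v` with `q ≠ 0`, `v(q) < 1`, `v(q) = v(j(W ⊗ K_v))⁻¹`
  AND **`tateJ q = j(W ⊗ K_v)`** (V.5.3 (a): "`q` … such that `j(E_q) = j(E)`", `j(E_q) = tateJ q =
  1/q + 744 + 196884 q + ⋯`), a square root `t` of `γ(W) = −c₄/c₆`, and a surjective homomorphism
  `Ψ : K̄_v^* → E(K̄_v)` with kernel `q^ℤ` and the twisted equivariance `σ • Ψ(u) = χ(σ) Ψ(σ u)`,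
  `χ(σ) = 1` iff `σ t = t`.

Why the extra clause (cell `bsd-2adic`, seat bsd-2adic-tower-1 GEN 8, scope memo
HOME/tower/SCOPE-hNS2one-kernel-GEN8.md module M3): the unit part of the Tate parameter modulo `8` at a place
above `2`, `q/2^{v(q)} ≡ (Δ_min/2^{v(Δ)})·c₄ (mod 8)`, is read off the INTEGER `q`-expansion
`q·j(q) = 1 + 744q + 196884q² + ⋯` (`TateSeriesFormal.hasSum_coeff_formalXJ`) through `j(q) = j(E) = c₄³/Δ`;
the `∃ q` of the predecessors cannot be linked to `j(E)` without this clause. The proof is the predecessor's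
verbatim (Steps 1–4 of `exists_twistedTateUniformisation_valuation`), keeping `hqj`. The
`NontriviallyNormedField` structure on `K_v` is introduced with `letI` inside the proof (no instance
attribute); `tateJ` in the statement uses the tree's registered `NormedField` instance on `v.adicCompletion K`,
definitionally the same.

## References
* [SilvermanATAEC1994] J. H. Silverman, *Advanced Topics in the Arithmetic of Elliptic Curves*, GTM 151,
  Springer 1994, Lemma V.5.1, Lemma V.5.2 (c), Thm. V.5.3 (a),(b) (PDF pp. 406–409), Thm. V.3.1 (b),(c),(d)
  (PDF p. 395).
-/

noncomputable section

open scoped Classical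
open NumberField IsDedekindDomain WeierstrassCurve Field

namespace Literature.NumberTheory.EllipticCurves.TateCurve

open SteinWuthrich2013 Literature.NumberTheory.EllipticCurves

variable {K : Type} [Field K] [NumberField K] (W : WeierstrassCurve K) [W.IsElliptic]
  (v : HeightOneSpectrum (𝓞 K))

/-- **Silverman *ATAEC* Thm. V.5.3 (a),(b) with Lemma V.5.1 / V.5.2 (c): the twisted Tate uniformisation at a
place of multiplicative reduction, WITH `j(E_q) = j(E)` and `v(q) = v(j)⁻¹`.** For an elliptic curve `W` over a
number field `K` with multiplicative reduction (split or non-split) at the finite place `v`, there are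
`q ∈ K_v` with `q ≠ 0`, `v(q) < 1`, `v(q) = v(j(W ⊗ K_v))⁻¹`, `tateJ q = j(W ⊗ K_v)` (V.5.3 (a): "there is a
unique `q` … such that `E` is isomorphic over `K̄` to the Tate curve `E_q`", i.e. `j(E_q) = j(E)`, with
`j(E_q) = tateJ q` by V.3.1 (b)), a square root `t ∈ K̄_v` of `γ(W/K) = −c₄/c₆`, and a surjective homomorphism
`Ψ : K̄_v^* → E(K̄_v)` with kernel `q^ℤ`, TWISTED-equivariant: `σ • Ψ(u) = χ(σ) Ψ(σ u)` with `χ(σ) = 1` iff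
`σ t = t` (Lemma V.5.2 (c)). Proof = the tree's `exists_twistedTateUniformisation_valuation`, keeping `tateJ q = j`.
[cite: SilvermanATAEC1994, Lemma V.5.1, Thm. V.5.3 (a),(b), Lemma V.5.2 (c) (PDF pp. 406–409)] -/
theorem exists_twistedTateUniformisation_tateJ (hmult : W.HasMultiplicativeReductionAt v) :
    ∃ (q : v.adicCompletion K) (t : AlgebraicClosure (v.adicCompletion K))
      (Ψ : Additive (AlgebraicClosure (v.adicCompletion K))ˣ →+ localPoints W (v.adicCompletion K)),
      q ≠ 0 ∧ Valued.v q < 1 ∧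
      Valued.v q = (Valued.v ((W.baseChange (v.adicCompletion K)).j))⁻¹ ∧
      tateJ q = (W.baseChange (v.adicCompletion K)).j ∧ t ≠ 0 ∧
      t ^ 2 = algebraMap (v.adicCompletion K) (AlgebraicClosure (v.adicCompletion K))
        (algebraMap K (v.adicCompletion K) (-(W.c₄ / W.c₆))) ∧
      Function.Surjective Ψ ∧
      (∀ u : (AlgebraicClosure (v.adicCompletion K))ˣ, Ψ (Additive.ofMul u) = 0 ↔
        ∃ n : ℤ, (u : AlgebraicClosure (v.adicCompletion K)) =
          algebraMap (v.adicCompletion K) (AlgebraicClosure (v.adicCompletion K)) q ^ n) ∧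
      (∀ (σ : absoluteGaloisGroup (v.adicCompletion K))
          (u : (AlgebraicClosure (v.adicCompletion K))ˣ),
        σ • Ψ (Additive.ofMul u) =
          (if Field.absoluteGaloisGroup.toAlgEquiv (v.adicCompletion K) σ t = t then (1 : ℤ)
            else -1) •
          Ψ (Additive.ofMul (Units.map
            (Field.absoluteGaloisGroup.toAlgEquiv (v.adicCompletion K) σ :
              AlgebraicClosure (v.adicCompletion K) →* AlgebraicClosure (v.adicCompletion K))
            u))) := by
  letI := GaloisRepresentations.Ultrametric.AdicCompletion.nontriviallyNormedField K v
  haveI := charZero_adicCompletion' K v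
  -- Step 1: `|j|_v > 1`, `c₄ c₆ ≠ 0`
  have hj := one_lt_norm_j_baseChange_of_hasMultiplicativeReductionAt W v hmult
  obtain ⟨hc₄, hc₆⟩ := c₄_ne_zero_and_c₆_ne_zero_of_hasMultiplicativeReductionAt W v hmult
  -- Step 2: the Tate parameter and an isomorphism `C` over `K̄_v` (V.5.3 (a))
  obtain ⟨q, hq0, hq, hqj, C, hC⟩ :=
    isomorphic_tateCurve_of_one_lt_norm_j_holds (W.baseChange (v.adicCompletion K)) hj
  obtain ⟨hEc₄, hEc₆⟩ := tateCurve_c₄_ne_zero_and_c₆_ne_zero W v hq0 hq hqj hj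
  -- the valuation of `q`: `‖j‖ = ‖tateJ q‖ = ‖q‖⁻¹` (Lemma V.5.1)
  have hqn : ‖q‖ = ‖(W.baseChange (v.adicCompletion K)).j‖⁻¹ := by
    rw [← hqj, norm_tateJ_eq hq, inv_inv]
  have hqv : Valued.v q = (Valued.v ((W.baseChange (v.adicCompletion K)).j))⁻¹ :=
    valuation_eq_inv_of_norm_eq_inv K v hqn
  -- the square root `t` of `γ(W)`
  obtain ⟨t, ht⟩ := IsAlgClosed.exists_pow_nat_eq
    (algebraMap (v.adicCompletion K) (AlgebraicClosure (v.adicCompletion K))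
      (algebraMap K (v.adicCompletion K) (-(W.c₄ / W.c₆)))) two_pos
  have ht0 : t ≠ 0 := by
    intro h
    have ht' := ht
    rw [h, zero_pow two_ne_zero, eq_comm, map_eq_zero, map_eq_zero, neg_eq_zero,
      div_eq_zero_iff] at ht'
    exact ht'.elim hc₄ hc₆
  -- Step 4: Tate's `φ` (V.3.1 (c),(d)) and the isomorphism of point groups `e = C`
  obtain ⟨φ, hsurj, hker, hequiv, -⟩ := uniformization_holds q hq0 hq
  obtain ⟨e, he⟩ : ∃ e : localPoints W (v.adicCompletion K) ≃+ geomPoints (tateCurve q),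
      ∀ P, e P = Affine.Point.congrEquiv hC (VariableChange.pointEquiv _ C
        (Affine.Point.congrEquiv (W.baseChange_baseChange_adicCompletion v).symm P)) :=
    ⟨(Affine.Point.congrEquiv (W.baseChange_baseChange_adicCompletion v).symm).trans
      ((VariableChange.pointEquiv ((W.baseChange (v.adicCompletion K)).baseChange
        (AlgebraicClosure (v.adicCompletion K))) C).trans (Affine.Point.congrEquiv hC)),
      fun _ ↦ rfl⟩
  have hsign := smul_eq_sign_smul W v hc₄ hc₆ hq hEc₄ hEc₆ C hC ht e he
  -- `Ψ = C⁻¹ ∘ φ`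
  refine ⟨q, t, e.symm.toAddMonoidHom.comp φ, hq0, ?_, hqv, hqj, ht0, ht, ?_, ?_, ?_⟩
  · exact (Valued.toNormedField.norm_lt_one_iff).mp hq
  · exact e.symm.surjective.comp hsurj
  · intro u
    rw [← hker u]
    change e.symm (φ (Additive.ofMul u)) = 0 ↔ _
    rw [AddEquiv.map_eq_zero_iff]
  · -- twisted equivariance: `σ Ψ(u) = χ(σ) Ψ(σ u)`
    intro σ u
    change σ • e.symm (φ (Additive.ofMul u)) = _ • e.symm (φ _)
    rw [← hequiv σ u]
    have h1 := hsign σ (e.symm (φ (Additive.ofMul u)))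
    rw [AddEquiv.apply_symm_apply] at h1
    apply e.injective
    rw [map_zsmul, AddEquiv.apply_symm_apply, h1, smul_smul]
    split_ifs <;> simp

end Literature.NumberTheory.EllipticCurves.TateCurve

end
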